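import Literature.MathematicalPhysics.QuantumFieldTheory.Balaban1983to89.B5ActionRate166
import Literature.MathematicalPhysics.QuantumFieldTheory.Balaban1983to89.B5Kernel166Decay

/-!
# `Balaban1983to89.T4GaugeActionRateStrip` — the η-RATE of Bałaban's `U = 1` effective gauge-field action (1.66)
# ON THE k-UNIFORM COMPLEX STRIP, and its position-space corollary (rate WITH exponential decay)

T. Bałaban, *Propagators and renormalization transformations for lattice gauge theories. I*, Commun. Math. Phys.
**95** (1984) 17–40 [`Balaban1984PropagatorsI`, cell paper B5]: (1.66) p. 29 (the `U = 1` quadratic form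
`⟨B, Δ_k B⟩` as a momentum integral with the multiplier `w_{μν}(p′)`), p. 38 the sentence before (1.126) (the
analyticity method for kernel decay).  C. King, Commun. Math. Phys. **103** (1986) 323–349, Props. 3.8/3.9 (the
EXPONENT CONVENTION `C·L^{−γk}`, `γ ≤ 1`, of an η-rate; location only, `T4EtaRate.rateFactor_eq_king`).

WHAT THIS FILE PROVES (kernel-checked, unconditional lattice statements; `U = 1`, `m² = 0` as in
`B5Bounds167Lattice` / `B5Symbol166`; constants crude and `d`-only):

* §1 A GENERIC TWO-CONSTANTS ENGINE [folklore: the Hadamard–Doetsch three-lines theorem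
  (`Complex.HadamardThreeLines.norm_le_interp_of_mem_verticalClosedStrip₀₁'`) transported from the vertical strip
  `0 ≤ Re w ≤ 1` into a coordinate box by `w ↦ x + i·c·sinh w`]: a function of `d` complex momenta that is
  holomorphic and bounded by `M` on the single-collar boxes, takes its real collar values inside the zone, and is
  bounded by `m` on the REAL Brillouin zone, is bounded by `m^{(1−t)^d} · M^{1−(1−t)^d}` on `Strip d (κ·sinh t/2)`
  (`strip_interpolation`; coordinate-by-coordinate induction).  Reusable for every strip-regular symbol family.
* §2 The collar facts for the continued (1.66) multiplier `W166` IN GENERAL POSITION: `2π`-periodicity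
  `W166 (tr p i) = W166 p` away from the strip sides (`W166_tr_gen`, from `B5Symbol166Strip.prodYc_tr_mul` /
  `F66_tr_mul`), near-side positivity of `Re Δ^ξ` (`re_DeltaXi_pos_near_side`), the zone representative `zoneRep`.
* §3 THE STRIP RATE: for `n₂ = R·n₁`, `μ ≠ ν`, `0 < t ≤ 1`:
  `sup_{Strip d (κ₁₆₆(d)·sinh t/2)} ‖W166 n₂ − W166 n₁‖ ≤ (Crate(d)·n₁⁻²)^{(1−t)^d} · (2·MW(d))^{1−(1−t)^d}`
  (`W166_strip_rate_family`, from the REAL rate `B5ActionRate166.w166_rate` and the strip bound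
  `B5Symbol166Strip.norm_W166_le`); with `t = 1/(2d)`: `‖W166 n₂ − W166 n₁‖ ≤ √(2·MW·Crate)·n₁⁻¹` on
  `Strip d (κ₁₆₆(d)/(4d))` (`W166_strip_rate`) — exponent `γ = 1`, King's convention exactly; King shape
  `n₁ = L^k`, `n₂ = L^{k+m}` uniform in `m` (`W166_strip_rate_king`); the entry symbol `Gsym` (`Gsym_strip_rate`).
* §4 `StripRegular` packages of the DIFFERENCES in dimension `d + 1` with bound = the rate.
* §5 POSITION SPACE WITH EXPONENTIAL DECAY on every torus `Π_μ ℤ/M_μ`, uniformly in the period vector: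
  `‖ksum_M^{(n₂)}(x̄) − ksum_M^{(n₁)}(x̄)‖ ≤ 8·CWs(d+1)·n₁⁻¹ · periodConst · e^{−(κ′/(d+1))|x|_{T,∞}}`,
  `κ′ = κ₁₆₆(d+1)/(4(d+1))` (`ksum_rate`; `B5Kernel166Decay.ksum_toT_eq_torusKernel` +
  `B4TorusKernel.MultiPeriod.torusKernel_descend_decay_torusMetric` applied to the difference).

HONEST SCOPE.  LINEAR THEORY ONLY (the `U = 1` multiplier of (1.66)); NOT the η-rate of the non-linear
renormalization map, NOT the background-field layer, NOT a continuum limit, NOT infinite volume, NOT a mass gap,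
NOT Clay.  No programme hypothesis (`BetaPertH`, `(B)`, `(B^μ)`) enters.  The exponent on the strip is
`2(1−t)^d < 2` (interpolation loss; `= 2` on the reals); the termwise `n⁻²` strip estimate through the complex
composition law is NOT attempted here.  Every `[cite]` below is a formula LOCATION; the method is textbook complex
analysis [folklore]; nothing printed is used as a hypothesis.
-/

noncomputable section

open Finset Complex

namespace Literature.MathematicalPhysics.QuantumFieldTheory.Balaban1983to89.T4GaugeActionRateStrip

open Literature.MathematicalPhysics.QuantumFieldTheory.Balaban1983to89.B4Strip
open Literature.MathematicalPhysics.QuantumFieldTheory.Balaban1983to89.B4StripCauchy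
open Literature.MathematicalPhysics.QuantumFieldTheory.Balaban1983to89.B5Symbol166
open Literature.MathematicalPhysics.QuantumFieldTheory.Balaban1983to89.B5Symbol166Strip
open Literature.MathematicalPhysics.QuantumFieldTheory.Balaban1983to89.B5Strip145Analytic
open Literature.MathematicalPhysics.QuantumFieldTheory.Balaban1983to89.B4ContourShift
open Literature.MathematicalPhysics.QuantumFieldTheory.Balaban1983to89.B5Bounds167Lattice
open Literature.MathematicalPhysics.QuantumFieldTheory.Balaban1983to89.B5ActionRate166

variable {d : ℕ}

/-! ## §1  The two-constants engine -/

/-- the transport map `φ_{x,c}(w) = x + i·c·sinh w` (vertical strip `0 ≤ Re w ≤ 1` → coordinate box around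
the real point `x`; `φ(iℝ) ⊂ ℝ`). [folklore] -/
def phiMap (x c : ℝ) (w : ℂ) : ℂ := (x : ℂ) + I * (c : ℂ) * Complex.sinh w

/-- real and imaginary parts of `φ_{x,c}(a + ib)`: `x − c·cosh a·sin b` and `c·sinh a·cos b`. [folklore] -/
theorem phiMap_eq (x c : ℝ) (w : ℂ) :
    phiMap x c w = ((x - c * Real.cosh w.re * Real.sin w.im : ℝ) : ℂ)
      + ((c * Real.sinh w.re * Real.cos w.im : ℝ) : ℂ) * I := by
  unfold phiMap
  conv_lhs => rw [← Complex.re_add_im w]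
  rw [Complex.sinh_add, Complex.cosh_mul_I, Complex.sinh_mul_I]
  push_cast
  linear_combination ((c : ℂ) * Complex.cosh (w.re : ℂ) * Complex.sin (w.im : ℂ)) * Complex.I_sq

/-- `Re φ_{x,c}(w) = x − c·cosh(Re w)·sin(Im w)`. [folklore] -/
theorem phiMap_re (x c : ℝ) (w : ℂ) : (phiMap x c w).re = x - c * Real.cosh w.re * Real.sin w.im := by
  rw [phiMap_eq, Complex.add_re, Complex.ofReal_re, Complex.re_ofReal_mul, Complex.I_re, mul_zero, add_zero]

/-- `Im φ_{x,c}(w) = c·sinh(Re w)·cos(Im w)`. [folklore] -/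
theorem phiMap_im (x c : ℝ) (w : ℂ) : (phiMap x c w).im = c * Real.sinh w.re * Real.cos w.im := by
  rw [phiMap_eq, Complex.add_im, Complex.ofReal_im, Complex.im_ofReal_mul, Complex.I_im, mul_one, zero_add]

/-- on the closed vertical strip `0 ≤ Re w ≤ 1` the transport map stays in the box of half-size `2|c|` around `x`:
`|Re φ − x| ≤ 2|c|`, `|Im φ| ≤ 2|c|`. [folklore] -/
theorem phiMap_bounds (x c : ℝ) {w : ℂ} (hw0 : 0 ≤ w.re) (hw1 : w.re ≤ 1) :
    |(phiMap x c w).re - x| ≤ 2 * |c| ∧ |(phiMap x c w).im| ≤ 2 * |c| := by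
  rw [phiMap_re, phiMap_im]
  have hcosh : Real.cosh w.re ≤ 2 := by
    have : Real.cosh w.re ≤ Real.cosh 1 :=
      Real.cosh_le_cosh.mpr (by rw [abs_of_nonneg hw0, abs_one]; exact hw1)
    refine this.trans ?_
    -- `cosh 1 ≤ 2` (also `Literature.NumberTheory.Automorphic.cosh_one_le_two`; re-derived in two lines to keep the
    -- import graph of the QFT cell free of the automorphic files)
    rw [Real.cosh_eq]
    have h1 : Real.exp 1 < 3 := lt_trans Real.exp_one_lt_d9 (by norm_num)
    have h2 : Real.exp (-1) ≤ 1 := Real.exp_le_one_iff.mpr (by norm_num)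
    linarith
  have hcosh0 : 0 < Real.cosh w.re := Real.cosh_pos _
  have hsinh0 : 0 ≤ Real.sinh w.re := Real.sinh_nonneg_iff.mpr hw0
  have hsinh : Real.sinh w.re ≤ 2 := (Real.sinh_lt_cosh _).le.trans hcosh
  have hs := Real.abs_sin_le_one w.im
  have hco := Real.abs_cos_le_one w.im
  have hc := abs_nonneg c
  constructor
  · rw [show x - c * Real.cosh w.re * Real.sin w.im - x = -(c * Real.cosh w.re * Real.sin w.im) by ring, abs_neg,
      abs_mul, abs_mul, abs_of_pos hcosh0]
    calc |c| * Real.cosh w.re * |Real.sin w.im| ≤ |c| * 2 * 1 := by gcongr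
      _ = 2 * |c| := by ring
  · rw [abs_mul, abs_mul, abs_of_nonneg hsinh0]
    calc |c| * Real.sinh w.re * |Real.cos w.im| ≤ |c| * 2 * 1 := by gcongr
      _ = 2 * |c| := by ring

open Complex.HadamardThreeLines in
/-- **TWO-CONSTANTS ESTIMATE ON A COORDINATE BOX.**  If `G` is holomorphic at every point of the closed box
`|Re z − x| ≤ κ`, `|Im z| ≤ κ` and bounded there by `M`, and bounded by `m ≥ 0` at the REAL points of the box, then at
height `y` with `2|y| ≤ κ·sinh t` (`0 < t ≤ 1`):  `‖G(x + iy)‖ ≤ m^{1−t} · M^t`.  (Hadamard's three-lines theorem for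
`w ↦ G(x + i (y/sinh t) sinh w)` on `0 ≤ Re w ≤ 1`: the line `Re w = 0` is mapped into the real points, the value at
`w = t` is `G(x + iy)`.) [folklore] -/
theorem norm_le_interp_of_box {G : ℂ → ℂ} {x y κ t M m : ℝ} (ht0 : 0 < t) (ht1 : t ≤ 1)
    (hy : 2 * |y| ≤ κ * Real.sinh t)
    (hdiff : ∀ z : ℂ, |z.re - x| ≤ κ → |z.im| ≤ κ → DifferentiableAt ℂ G z)
    (hM : ∀ z : ℂ, |z.re - x| ≤ κ → |z.im| ≤ κ → ‖G z‖ ≤ M)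
    (hreal : ∀ s : ℝ, |s - x| ≤ κ → ‖G s‖ ≤ m) :
    ‖G (x + y * I)‖ ≤ m ^ (1 - t) * M ^ t := by
  have hst : 0 < Real.sinh t := Real.sinh_pos_iff.mpr ht0
  set c : ℝ := y / Real.sinh t with hc
  have hc2 : 2 * |c| ≤ κ := by
    rw [hc, abs_div, abs_of_pos hst, mul_div_assoc', div_le_iff₀ hst]
    exact hy
  set f : ℂ → ℂ := fun w => G (phiMap x c w) with hf
  have hbox : ∀ w : ℂ, w ∈ verticalClosedStrip 0 1 →
      |(phiMap x c w).re - x| ≤ κ ∧ |(phiMap x c w).im| ≤ κ := by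
    intro w hw
    have hw' : 0 ≤ w.re ∧ w.re ≤ 1 := by
      simpa [verticalClosedStrip, Set.mem_preimage, Set.mem_Icc] using hw
    obtain ⟨h1, h2⟩ := phiMap_bounds x c hw'.1 hw'.2
    exact ⟨h1.trans hc2, h2.trans hc2⟩
  have hdf : ∀ w ∈ verticalClosedStrip 0 1, DifferentiableAt ℂ f w := by
    intro w hw
    obtain ⟨h1, h2⟩ := hbox w hw
    have hφ : DifferentiableAt ℂ (phiMap x c) w := by
      unfold phiMap
      exact (differentiableAt_const _).add ((differentiableAt_const _).mul (Complex.differentiable_sinh w))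
    exact (hdiff _ h1 h2).comp w hφ
  have hd : DiffContOnCl ℂ f (verticalStrip 0 1) := by
    apply DifferentiableOn.diffContOnCl
    rw [verticalStrip, Complex.closure_preimage_re, closure_Ioo zero_ne_one]
    exact fun w hw => (hdf w hw).differentiableWithinAt
  have hB : BddAbove ((norm ∘ f) '' verticalClosedStrip 0 1) := by
    refine ⟨M, ?_⟩
    rintro _ ⟨w, hw, rfl⟩
    obtain ⟨h1, h2⟩ := hbox w hw
    exact hM _ h1 h2
  have ha : ∀ w ∈ re ⁻¹' {(0 : ℝ)}, ‖f w‖ ≤ m := by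
    intro w hw
    have hw0 : w.re = 0 := hw
    have him : (phiMap x c w).im = 0 := by rw [phiMap_im, hw0, Real.sinh_zero]; ring
    have hmem : w ∈ verticalClosedStrip 0 1 := by
      simp [verticalClosedStrip, Set.mem_preimage, hw0]
    have hre : |(phiMap x c w).re - x| ≤ κ := (hbox w hmem).1
    have heq : phiMap x c w = (((phiMap x c w).re : ℝ) : ℂ) := by
      apply Complex.ext <;> simp [him]
    show ‖G (phiMap x c w)‖ ≤ m
    rw [heq]
    exact hreal _ hre
  have hb : ∀ w ∈ re ⁻¹' {(1 : ℝ)}, ‖f w‖ ≤ M := by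
    intro w hw
    have hw1 : w.re = 1 := hw
    have hmem : w ∈ verticalClosedStrip 0 1 := by
      simp [verticalClosedStrip, Set.mem_preimage, hw1]
    obtain ⟨h1, h2⟩ := hbox w hmem
    exact hM _ h1 h2
  have ht : (t : ℂ) ∈ verticalClosedStrip 0 1 := by
    simp [verticalClosedStrip, Set.mem_preimage, Complex.ofReal_re, ht0.le, ht1]
  have key := norm_le_interp_of_mem_verticalClosedStrip₀₁' f ht hd hB ha hb
  have hφt : phiMap x c t = x + y * I := by
    unfold phiMap
    rw [← Complex.ofReal_sinh]
    have : (c : ℂ) * (Real.sinh t : ℂ) = y := by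
      rw [hc]
      push_cast
      exact div_mul_cancel₀ _ (by exact_mod_cast hst.ne')
    linear_combination I * this
  simpa [hf, hφt, Complex.ofReal_re] using key

/-- the SINGLE-COLLAR SET in direction `i` of size `κ`: every other coordinate in the zone strip of half-width `κ`,
coordinate `i` in the box `|Re| ≤ π + κ`, `|Im| ≤ κ`. [folklore] -/
def Collar (d : ℕ) (κ : ℝ) (i : Fin d) : Set (Fin d → ℂ) :=
  {q | (∀ ν, ν ≠ i → |(q ν).re| ≤ Real.pi ∧ |(q ν).im| ≤ κ) ∧ |(q i).re| ≤ Real.pi + κ ∧ |(q i).im| ≤ κ}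

/-- the `j`-th INTERPOLATION SET: zone real parts, imaginary parts `≤ κ'`, the first `j` coordinates real. [folklore] -/
def Tset (d : ℕ) (κ' : ℝ) (j : ℕ) : Set (Fin d → ℂ) :=
  {q | ∀ ν : Fin d, |(q ν).re| ≤ Real.pi ∧ |(q ν).im| ≤ κ' ∧ ((ν : ℕ) < j → (q ν).im = 0)}

/-- `Tset d κ' 0 = Strip d κ'`. [folklore] -/
theorem Tset_zero (κ' : ℝ) : Tset d κ' 0 = Strip d κ' := by
  ext q
  simp [Tset, Strip]

/-- the exponent bookkeeping of one interpolation step: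
`(m^a M^{1−a})^{1−t} M^t = m^{a(1−t)} M^{1−a(1−t)}`. [folklore] -/
theorem interp_exponent_step {m M a t : ℝ} (hm : 0 ≤ m) (hM : 0 ≤ M) (ha1 : a ≤ 1)
    (ht0 : 0 ≤ t) (ht1 : t ≤ 1) :
    (m ^ a * M ^ (1 - a)) ^ (1 - t) * M ^ t = m ^ (a * (1 - t)) * M ^ (1 - a * (1 - t)) := by
  rw [Real.mul_rpow (Real.rpow_nonneg hm _) (Real.rpow_nonneg hM _), ← Real.rpow_mul hm, ← Real.rpow_mul hM,
    show 1 - a * (1 - t) = (1 - a) * (1 - t) + t by ring,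
    Real.rpow_add_of_nonneg hM (mul_nonneg (by linarith) (by linarith)) ht0]
  ring

/-- **STRIP INTERPOLATION** (coordinate by coordinate): let `g : ℂ^d → ℂ` be holomorphic with `‖g‖ ≤ M` on every
single-collar set of size `κ`, take each of its real collar values already inside the zone
(`g(q) = g(q[i ↦ s'])`, `|s'| ≤ π`, whenever `q_i` is real), and satisfy `‖g‖ ≤ m` on the real Brillouin zone.  Then for
`0 < t ≤ 1` and `2κ' ≤ κ·sinh t` (`0 ≤ κ' ≤ κ`):  `‖g(p)‖ ≤ m^{(1−t)^d} · M^{1−(1−t)^d}` on `Strip d κ'`. [folklore] -/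
theorem strip_interpolation {g : (Fin d → ℂ) → ℂ} {κ κ' t M m : ℝ} (hκ' : 0 ≤ κ') (hκ'κ : κ' ≤ κ)
    (ht0 : 0 < t) (ht1 : t ≤ 1) (hreach : 2 * κ' ≤ κ * Real.sinh t) (hm : 0 ≤ m) (hM0 : 0 ≤ M)
    (hD : ∀ i, ∀ q ∈ Collar d κ i, DifferentiableAt ℂ g q ∧ ‖g q‖ ≤ M)
    (hP : ∀ i, ∀ q ∈ Collar d κ i, (q i).im = 0 → ∃ s' : ℝ, |s'| ≤ Real.pi ∧ g q = g (Function.update q i s'))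
    (hR : ∀ s : Fin d → ℝ, (∀ ν, |s ν| ≤ Real.pi) → ‖g (ofRealVec s)‖ ≤ m) :
    ∀ p ∈ Strip d κ', ‖g p‖ ≤ m ^ ((1 - t) ^ d) * M ^ (1 - (1 - t) ^ d) := by
  have h1t : 0 ≤ 1 - t := by linarith
  have h1t1 : 1 - t ≤ 1 := by linarith
  have claim : ∀ k : ℕ, k ≤ d → ∀ q ∈ Tset d κ' (d - k),
      ‖g q‖ ≤ m ^ ((1 - t) ^ k) * M ^ (1 - (1 - t) ^ k) := by
    intro k
    induction k with
    | zero =>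
      intro _ q hq
      have hreal : q = ofRealVec (fun ν => (q ν).re) := by
        funext ν
        have him : (q ν).im = 0 := (hq ν).2.2 (by simp [ν.isLt])
        apply Complex.ext <;> simp [ofRealVec, him]
      rw [pow_zero, Real.rpow_one, sub_self, Real.rpow_zero, mul_one, hreal]
      exact hR _ (fun ν => (hq ν).1)
    | succ k ih =>
      intro hk q hq
      have hjd : d - (k + 1) < d := by omega
      set i : Fin d := ⟨d - (k + 1), hjd⟩ with hi
      have hB := ih (by omega)
      have hdk : d - k = d - (k + 1) + 1 := by omega
      rw [hdk] at hB
      set x : ℝ := (q i).re with hx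
      set y : ℝ := (q i).im with hy
      have hyk : |y| ≤ κ' := (hq i).2.1
      have hκ0 : 0 ≤ κ := hκ'.trans hκ'κ
      have hmem : ∀ z : ℂ, |z.re - x| ≤ κ → |z.im| ≤ κ → Function.update q i z ∈ Collar d κ i := by
        intro z hz1 hz2
        refine ⟨fun ν hν => ?_, ?_, ?_⟩
        · rw [Function.update_of_ne hν]
          exact ⟨(hq ν).1, (hq ν).2.1.trans hκ'κ⟩
        · rw [Function.update_self]
          have hxπ : |x| ≤ Real.pi := (hq i).1
          calc |z.re| = |(z.re - x) + x| := by ring_nf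
            _ ≤ |z.re - x| + |x| := abs_add_le _ _
            _ ≤ κ + Real.pi := add_le_add hz1 hxπ
            _ = Real.pi + κ := add_comm _ _
        · rw [Function.update_self]
          exact hz2
      have key := norm_le_interp_of_box (G := fun z => g (Function.update q i z)) (x := x) (y := y) (κ := κ)
        (t := t) (M := M) (m := m ^ ((1 - t) ^ k) * M ^ (1 - (1 - t) ^ k)) ht0 ht1
        ((mul_le_mul_of_nonneg_left hyk (by norm_num)).trans hreach)
        (fun z hz1 hz2 => ((hD i _ (hmem z hz1 hz2)).1).comp z (differentiableAt_update q i z))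
        (fun z hz1 hz2 => (hD i _ (hmem z hz1 hz2)).2) ?_
      · have hq' : Function.update q i ((x : ℂ) + y * I) = q := by
          rw [hx, hy, Complex.re_add_im (q i)]
          exact Function.update_eq_self i q
        simp only [hq'] at key
        refine key.trans (le_of_eq ?_)
        rw [interp_exponent_step hm hM0 (pow_le_one₀ h1t h1t1) ht0.le ht1, ← pow_succ]
      · intro s hs
        have hmem' : Function.update q i (s : ℂ) ∈ Collar d κ i :=
          hmem (s : ℂ) (by simpa using hs) (by simp [hκ0])
        obtain ⟨s', hs', heq⟩ := hP i _ hmem' (by simp)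
        rw [heq, Function.update_idem]
        apply hB
        intro ν
        by_cases hν : ν = i
        · subst hν
          rw [Function.update_self]
          exact ⟨by simpa using hs', by simp [hκ'], fun _ => by simp⟩
        · rw [Function.update_of_ne hν]
          refine ⟨(hq ν).1, (hq ν).2.1, fun hlt => (hq ν).2.2 ?_⟩
          have hne : (ν : ℕ) ≠ d - (k + 1) := fun h => hν (Fin.ext h)
          omega
  intro p hp
  have := claim d le_rfl p (by rw [Nat.sub_self, Tset_zero]; exact hp)
  exact this

/-! ## §2  Collar facts for the continued (1.66) multiplier `W166` in general position -/

/-- `3 ≤ 4n² sin²(x/2n)` for `π − 1/4 ≤ |x| ≤ π + 1/4` and `n ≥ 1` (Jordan's inequality for `n ≥ 2`, a cosine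
bound for `n = 1`). [folklore] -/
theorem three_le_scaled_sin_sq (n : ℕ) (hn : 1 ≤ n) {x : ℝ} (hlo : Real.pi - 1 / 4 ≤ |x|)
    (hhi : |x| ≤ Real.pi + 1 / 4) : 3 ≤ 4 * (n : ℝ) ^ 2 * Real.sin (x / (2 * n)) ^ 2 := by
  have hπ := Real.pi_gt_three
  have hπ4 := Real.pi_le_four
  have hsq : Real.sin (x / (2 * n)) ^ 2 = Real.sin (|x| / (2 * n)) ^ 2 := by
    rcases abs_choice x with h | h
    · rw [h]
    · rw [h, neg_div, Real.sin_neg, neg_sq]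
  rw [hsq]
  rcases Nat.lt_or_ge n 2 with h1 | h2
  · have hn1 : n = 1 := by omega
    subst hn1
    simp only [Nat.cast_one, one_pow, mul_one]
    have hu : |(|x| / 2 - Real.pi / 2)| ≤ 1 / 8 := by
      rw [abs_le]; constructor <;> linarith
    have hc : 1 - (|x| / 2 - Real.pi / 2) ^ 2 / 2 ≤ Real.sin (|x| / 2) := by
      rw [← Real.cos_sub_pi_div_two]; exact Real.one_sub_sq_div_two_le_cos
    have hsq2 : (|x| / 2 - Real.pi / 2) ^ 2 ≤ (1 / 8) ^ 2 := by
      rw [← sq_abs]; exact pow_le_pow_left₀ (abs_nonneg _) hu 2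
    have hs0 : 31 / 32 ≤ Real.sin (|x| / 2) := by linarith
    nlinarith
  · have hnr : (0 : ℝ) < n := by positivity
    have hn2 : (2 : ℝ) ≤ n := by exact_mod_cast h2
    have hxn : |x| ≤ Real.pi * n := by nlinarith [abs_nonneg x]
    have hj := scaled_jordan hnr (abs_nonneg x) hxn
    have h3 : 3 ≤ 4 / Real.pi ^ 2 * |x| ^ 2 := by
      have h0 : 0 ≤ Real.pi - 1 / 4 := by linarith
      have hx2 : (Real.pi - 1 / 4) ^ 2 ≤ |x| ^ 2 := pow_le_pow_left₀ h0 hlo 2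
      have hπ2 : 0 < Real.pi ^ 2 := by positivity
      rw [div_mul_eq_mul_div, le_div_iff₀ hπ2]
      nlinarith
    linarith

/-- NEAR-SIDE POSITIVITY of `Re Δ^ξ`: if all `|Im q_ν| ≤ κ ≤ 1`, `dκ² ≤ 1/16`, and ONE coordinate has
`π − 1/4 ≤ |Re q_i| ≤ π + 1/4` (the other real parts arbitrary), then `Re Δ^ξ(q) > 0` (cf.
`B5Strip145Analytic.re_DeltaXi_pos_of_edge`, the case `Re q_i = −π`). [folklore] -/
theorem re_DeltaXi_pos_near_side (n : ℕ) [NeZero n] {κ : ℝ} (hκ1 : κ ≤ 1) (hdκ : (d : ℝ) * κ ^ 2 ≤ 1 / 16)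
    {q : Fin d → ℂ} (hIm : ∀ ν, |(q ν).im| ≤ κ) (i : Fin d)
    (hlo : Real.pi - 1 / 4 ≤ |(q i).re|) (hhi : |(q i).re| ≤ Real.pi + 1 / 4) : 0 < (DeltaXi n 0 q).re := by
  have hn : 1 ≤ n := Nat.one_le_iff_ne_zero.mpr (NeZero.ne n)
  have hre : (DeltaXi n 0 q).re = ∑ ν, (Sxi n (q ν)).re := by
    simp [DeltaXi, Complex.re_sum]
  have h1 : ∀ ν, 4 * (n : ℝ) ^ 2 * Real.sin ((q ν).re / (2 * n)) ^ 2 - 25 / 16 * (q ν).im ^ 2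
      ≤ (Sxi n (q ν)).re := fun ν => re_Sxi_ge n hn (q ν) ((hIm ν).trans hκ1)
  have h2 : ∀ ν, (q ν).im ^ 2 ≤ κ ^ 2 := fun ν => by
    rw [← sq_abs]; exact pow_le_pow_left₀ (abs_nonneg _) (hIm ν) 2
  have hsum : ∑ ν, (4 * (n : ℝ) ^ 2 * Real.sin ((q ν).re / (2 * n)) ^ 2 - 25 / 16 * κ ^ 2)
      ≤ ∑ ν, (Sxi n (q ν)).re := by
    apply Finset.sum_le_sum
    intro ν _
    have := h1 ν
    have := h2 ν
    nlinarith
  have hsingle : 4 * (n : ℝ) ^ 2 * Real.sin ((q i).re / (2 * n)) ^ 2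
      ≤ ∑ ν, 4 * (n : ℝ) ^ 2 * Real.sin ((q ν).re / (2 * n)) ^ 2 :=
    Finset.single_le_sum (f := fun ν => 4 * (n : ℝ) ^ 2 * Real.sin ((q ν).re / (2 * n)) ^ 2)
      (fun ν _ => by positivity) (Finset.mem_univ i)
  have h3 := three_le_scaled_sin_sq n hn hlo hhi
  rw [Finset.sum_sub_distrib, Finset.sum_const, Finset.card_univ, Fintype.card_fin, nsmul_eq_mul] at hsum
  rw [hre]
  nlinarith

/-- transfer of the non-vanishing of `F` along the `2π`-translation in direction `i` (from the quasi-periodicity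
identity `B5Symbol166Strip.F66_tr_mul`). [folklore] -/
theorem F66_tr_ne_zero_iff (n : ℕ) [NeZero n] (p : Fin d → ℂ) (i : Fin d) (hz : p i ≠ 0)
    (hz' : p i + 2 * Real.pi ≠ 0) (h0 : DeltaXi n 0 p ≠ 0) (h1 : DeltaXi n 0 (tr p i) ≠ 0) :
    F66 n (tr p i) ≠ 0 ↔ F66 n p ≠ 0 := by
  have h := F66_tr_mul n p i hz hz' h0 h1
  constructor
  · intro hF hFp
    rw [hFp, mul_zero, mul_zero] at h
    exact (mul_ne_zero (mul_ne_zero h1 hF) (pow_ne_zero _ h0)) h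
  · intro hF hFt
    rw [hFt, mul_zero, zero_mul] at h
    exact (mul_ne_zero (pow_ne_zero _ h1) (mul_ne_zero h0 hF)) h.symm

/-- `2π`-PERIODICITY OF `W_{μν}` IN GENERAL POSITION: `W(tr p i) = W(p)` whenever `p_i ∉ {0, −2π}`,
`Δ^ξ(p) ≠ 0`, `Δ^ξ(tr p i) ≠ 0`, `F(p) ≠ 0` (the proof of `B5Symbol166Strip.W166_tr` verbatim, with its side
hypothesis `Re p_i = −π` replaced by these four conditions). [folklore] -/
theorem W166_tr_gen (n : ℕ) [NeZero n] {p : Fin d → ℂ} (i : Fin d) (hz : p i ≠ 0)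
    (hz' : p i + 2 * Real.pi ≠ 0) (h0 : DeltaXi n 0 p ≠ 0) (h1 : DeltaXi n 0 (tr p i) ≠ 0)
    (hFp : F66 n p ≠ 0) {μ ν : Fin d} (hμν : μ ≠ ν) : W166 n μ ν (tr p i) = W166 n μ ν p := by
  have hd := two_le_of_ne hμν
  have hFt : F66 n (tr p i) ≠ 0 := (F66_tr_ne_zero_iff n p i hz hz' h0 h1).mpr hFp
  have hν : ν ∈ univ.erase μ := Finset.mem_erase.mpr ⟨hμν.symm, Finset.mem_univ ν⟩
  have hcard : ((univ.erase μ).erase ν).card = d - 2 := by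
    rw [Finset.card_erase_of_mem hν, Finset.card_erase_of_mem (Finset.mem_univ μ), Finset.card_univ,
      Fintype.card_fin]
    omega
  have hP := prodYc_tr_mul n ((univ.erase μ).erase ν) p i hz hz' h0 h1
  rw [hcard] at hP
  have hF := F66_tr_mul n p i hz hz' h0 h1
  have hd1 : d - 1 = (d - 2) + 1 := by omega
  rw [hd1] at hF
  unfold W166
  rw [div_eq_div_iff hFt hFp]
  have hX : DeltaXi n 0 p ^ (d - 2 + 1) * DeltaXi n 0 (tr p i) ^ (d - 2 + 1) ≠ 0 :=
    mul_ne_zero (pow_ne_zero _ h0) (pow_ne_zero _ h1)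
  refine mul_right_cancel₀ hX ?_
  linear_combination (F66 n p * DeltaXi n 0 p * DeltaXi n 0 (tr p i) ^ (d - 2 + 1)) * hP
    - ((∏ lam ∈ (univ.erase μ).erase ν, Yc n lam p) * DeltaXi n 0 (tr p i) ^ (d - 2)) * hF

/-- the ZONE REPRESENTATIVE of a collar point: coordinate `i` translated by `∓2π` back into `|Re| ≤ π` when it
sticks out. [folklore] -/
def zoneRep (q : Fin d → ℂ) (i : Fin d) : Fin d → ℂ :=
  if Real.pi < (q i).re then Function.update q i (q i - 2 * Real.pi)
  else if (q i).re < -Real.pi then Function.update q i (q i + 2 * Real.pi) else q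

/-- `zoneRep` does not touch the other coordinates. [folklore] -/
theorem zoneRep_of_ne (q : Fin d → ℂ) {i ν : Fin d} (hν : ν ≠ i) : zoneRep q i ν = q ν := by
  unfold zoneRep
  split_ifs <;> simp [Function.update_of_ne hν]

/-- `zoneRep` keeps the imaginary part of coordinate `i`. [folklore] -/
theorem zoneRep_im (q : Fin d → ℂ) (i : Fin d) : (zoneRep q i i).im = (q i).im := by
  unfold zoneRep
  split_ifs <;> simp

/-- the zone representative of a collar point lies in the strip (`κ ≤ 2π`). [folklore] -/
theorem zoneRep_mem_Strip {κ : ℝ} (hκ : κ ≤ 2 * Real.pi) {i : Fin d} {q : Fin d → ℂ}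
    (hq : q ∈ Collar d κ i) : zoneRep q i ∈ Strip d κ := by
  have hπ := Real.pi_pos
  intro ν
  by_cases hν : ν = i
  · subst hν
    refine ⟨?_, by rw [zoneRep_im]; exact hq.2.2⟩
    have h := hq.2.1
    unfold zoneRep
    by_cases hgt : Real.pi < (q ν).re
    · rw [if_pos hgt, Function.update_self]
      have : (q ν - 2 * (Real.pi : ℂ)).re = (q ν).re - 2 * Real.pi := by simp
      rw [this, abs_le]
      rw [abs_of_pos (by linarith)] at h
      constructor <;> linarith
    · by_cases hlt : (q ν).re < -Real.pi
      · rw [if_neg hgt, if_pos hlt, Function.update_self]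
        have : (q ν + 2 * (Real.pi : ℂ)).re = (q ν).re + 2 * Real.pi := by simp
        rw [this, abs_le]
        rw [abs_of_neg (by linarith)] at h
        constructor <;> linarith
      · rw [if_neg hgt, if_neg hlt]
        exact abs_le.mpr ⟨by linarith, by linarith⟩
  · rw [zoneRep_of_ne q hν]
    exact hq.1 ν hν

/-- a collar point of size `κ ≤ r` is a fat point of size `r`. [folklore] -/
theorem collar_subset_fat {κ r : ℝ} (hκ0 : 0 ≤ κ) (hκ : κ ≤ r) {i : Fin d} {q : Fin d → ℂ}
    (hq : q ∈ Collar d κ i) : q ∈ Fat d r := by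
  intro ν
  by_cases hν : ν = i
  · subst hν
    exact ⟨hq.2.1.trans (by linarith), hq.2.2.trans (by linarith)⟩
  · obtain ⟨h1, h2⟩ := hq.1 ν hν
    exact ⟨h1.trans (by linarith), h2.trans (by linarith)⟩

/-- THE COLLAR FACTS for `W_{μν}` (`μ ≠ ν`, `0 ≤ κ ≤ κ₁₆₆(d)`): on the single-collar set `F ≠ 0` and `W` takes the value
of the zone representative (periodicity in general position + near-side positivity of `Re Δ^ξ`). [folklore] -/
theorem collar_main (n : ℕ) [NeZero n] {κ : ℝ} (hκ0 : 0 ≤ κ) (hκ : κ ≤ kappa166 d) {i : Fin d}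
    {q : Fin d → ℂ} (hq : q ∈ Collar d κ i) {μ ν : Fin d} (hμν : μ ≠ ν) :
    F66 n q ≠ 0 ∧ W166 n μ ν q = W166 n μ ν (zoneRep q i) := by
  have hπ := Real.pi_gt_three
  obtain ⟨hκ1, hdκ⟩ := kappa_small hκ0 (hκ.trans (kappa166_le_rOf d))
  have hκ4 : κ ≤ 1 / 4 := (hκ.trans (kappa166_le_rOf d)).trans (rOf_le d)
  have hIm : ∀ ν, |(q ν).im| ≤ κ := fun ν => by
    by_cases h : ν = i
    · subst h; exact hq.2.2
    · exact (hq.1 ν h).2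
  have hS : zoneRep q i ∈ Strip d κ := zoneRep_mem_Strip (by linarith) hq
  have hFz : F66 n (zoneRep q i) ≠ 0 := F66_ne_zero_of_mem n hκ0 hκ hS
  have hri := hq.2.1
  by_cases hgt : Real.pi < (q i).re
  · have hzr : zoneRep q i = Function.update q i (q i - 2 * Real.pi) := by
      unfold zoneRep; rw [if_pos hgt]
    rw [hzr] at hFz ⊢
    set p : Fin d → ℂ := Function.update q i (q i - 2 * Real.pi) with hp
    have hpi : p i = q i - 2 * Real.pi := by rw [hp, Function.update_self]
    have htr : tr p i = q := by
      unfold tr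
      rw [hpi, hp, Function.update_idem, sub_add_cancel, Function.update_eq_self]
    have hub : (q i).re ≤ Real.pi + κ := by rw [abs_of_pos (by linarith)] at hri; exact hri
    have hpre : (p i).re = (q i).re - 2 * Real.pi := by rw [hpi]; simp
    have hz : p i ≠ 0 := by
      intro h; have := congrArg Complex.re h; rw [hpre, Complex.zero_re] at this; linarith
    have hz' : p i + 2 * Real.pi ≠ 0 := by
      rw [hpi, sub_add_cancel]
      intro h; have := congrArg Complex.re h; rw [Complex.zero_re] at this; linarith
    have hImp : ∀ ν, |(p ν).im| ≤ κ := by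
      intro ν
      by_cases h : ν = i
      · subst h; rw [hpi]; simpa using hIm ν
      · rw [hp, Function.update_of_ne h]; exact hIm ν
    have h0 : DeltaXi n 0 p ≠ 0 := by
      have habs : |(p i).re| = 2 * Real.pi - (q i).re := by
        rw [hpre, abs_of_neg (by linarith)]; ring
      have := re_DeltaXi_pos_near_side n hκ1 hdκ hImp i (by rw [habs]; linarith) (by rw [habs]; linarith)
      intro h; rw [h, Complex.zero_re] at this; exact lt_irrefl _ this
    have h1 : DeltaXi n 0 (tr p i) ≠ 0 := by
      rw [htr]
      have habs : |(q i).re| = (q i).re := abs_of_pos (by linarith)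
      have := re_DeltaXi_pos_near_side n hκ1 hdκ hIm i (by rw [habs]; linarith) (by rw [habs]; linarith)
      intro h; rw [h, Complex.zero_re] at this; exact lt_irrefl _ this
    have hFq : F66 n q ≠ 0 := by
      have := (F66_tr_ne_zero_iff n p i hz hz' h0 h1).mpr hFz
      rwa [htr] at this
    have hW := W166_tr_gen n i hz hz' h0 h1 hFz hμν
    rw [htr] at hW
    exact ⟨hFq, hW⟩
  · by_cases hlt : (q i).re < -Real.pi
    · have hzr : zoneRep q i = tr q i := by
        unfold zoneRep tr; rw [if_neg hgt, if_pos hlt]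
      rw [hzr] at hFz ⊢
      have hlb : -Real.pi - κ ≤ (q i).re := by rw [abs_of_neg (by linarith)] at hri; linarith
      have hz : q i ≠ 0 := by
        intro h; have := congrArg Complex.re h; rw [Complex.zero_re] at this; linarith
      have hz' : q i + 2 * Real.pi ≠ 0 := by
        intro h; have := congrArg Complex.re h; simp at this; linarith
      have h0 : DeltaXi n 0 q ≠ 0 := by
        have habs : |(q i).re| = -(q i).re := abs_of_neg (by linarith)
        have := re_DeltaXi_pos_near_side n hκ1 hdκ hIm i (by rw [habs]; linarith) (by rw [habs]; linarith)
        intro h; rw [h, Complex.zero_re] at this; exact lt_irrefl _ this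
      have hImt : ∀ ν, |(tr q i ν).im| ≤ κ := by
        intro ν
        by_cases h : ν = i
        · subst h; rw [tr_im]; exact hIm ν
        · rw [tr_apply_of_ne h]; exact hIm ν
      have h1 : DeltaXi n 0 (tr q i) ≠ 0 := by
        have hre : (tr q i i).re = (q i).re + 2 * Real.pi := by rw [tr_re_self]
        have habs : |(tr q i i).re| = (q i).re + 2 * Real.pi := by rw [hre, abs_of_pos (by linarith)]
        have := re_DeltaXi_pos_near_side n hκ1 hdκ hImt i (by rw [habs]; linarith) (by rw [habs]; linarith)
        intro h; rw [h, Complex.zero_re] at this; exact lt_irrefl _ this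
      have hFq : F66 n q ≠ 0 := (F66_tr_ne_zero_iff n q i hz hz' h0 h1).mp hFz
      exact ⟨hFq, (W166_tr_gen n i hz hz' h0 h1 hFq hμν).symm⟩
    · have hzr : zoneRep q i = q := by
        unfold zoneRep; rw [if_neg hgt, if_neg hlt]
      rw [hzr] at hFz ⊢
      exact ⟨hFz, rfl⟩

/-- `W_{μν}` (`μ ≠ ν`) is HOLOMORPHIC and BOUNDED BY `MW d` on every single-collar set of size `κ ≤ κ₁₆₆(d)`. [folklore] -/
theorem W166_collar (n : ℕ) [NeZero n] {κ : ℝ} (hκ0 : 0 ≤ κ) (hκ : κ ≤ kappa166 d) {i : Fin d}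
    {q : Fin d → ℂ} (hq : q ∈ Collar d κ i) {μ ν : Fin d} (hμν : μ ≠ ν) :
    DifferentiableAt ℂ (fun p => W166 n μ ν p) q ∧ ‖W166 n μ ν q‖ ≤ MW d := by
  have hπ := Real.pi_gt_three
  obtain ⟨hF, hW⟩ := collar_main n hκ0 hκ hq hμν
  have hκr : κ ≤ rOf d := hκ.trans (kappa166_le_rOf d)
  have hκ4 : κ ≤ 1 / 4 := hκr.trans (rOf_le d)
  refine ⟨differentiableAt_W166 n (rOf_le d) (d_mul_rOf_sq_le d) (collar_subset_fat hκ0 hκr hq) μ ν hF, ?_⟩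
  rw [hW]
  exact norm_W166_le n hκ0 hκ (zoneRep_mem_Strip (by linarith) hq) μ ν

/-- the REAL COLLAR VALUES of `W_{μν}` are zone values: if `q_i` is real, `W(q) = W(q[i ↦ s'])` with `|s'| ≤ π`.
[folklore] -/
theorem W166_collar_real (n : ℕ) [NeZero n] {κ : ℝ} (hκ0 : 0 ≤ κ) (hκ : κ ≤ kappa166 d) {i : Fin d}
    {q : Fin d → ℂ} (hq : q ∈ Collar d κ i) (him : (q i).im = 0) {μ ν : Fin d} (hμν : μ ≠ ν) :
    |(zoneRep q i i).re| ≤ Real.pi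
      ∧ W166 n μ ν q = W166 n μ ν (Function.update q i (((zoneRep q i i).re : ℝ) : ℂ)) := by
  have hπ := Real.pi_gt_three
  have hκ4 : κ ≤ 1 / 4 := ((hκ.trans (kappa166_le_rOf d))).trans (rOf_le d)
  have hS := zoneRep_mem_Strip (show κ ≤ 2 * Real.pi by linarith) hq
  refine ⟨(hS i).1, ?_⟩
  have hz : zoneRep q i = Function.update q i (((zoneRep q i i).re : ℝ) : ℂ) := by
    funext ν
    by_cases hν : ν = i
    · subst hν
      rw [Function.update_self]
      apply Complex.ext
      · simp
      · rw [zoneRep_im, him]; simp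
    · rw [Function.update_of_ne hν, zoneRep_of_ne q hν]
  rw [← hz]
  exact (collar_main n hκ0 hκ hq hμν).2

/-! ## §3  The strip rate of `W166` -/

/-- `W_{μν}(0) = 1` for every `n` (all `Y_λ(0) = 1`, `F(0) = 1`). [folklore] -/
theorem W166_origin (n : ℕ) [NeZero n] (μ ν : Fin d) :
    W166 n μ ν (ofRealVec fun _ : Fin d => (0 : ℝ)) = 1 := by
  have hΔ : DeltaXi n 0 (ofRealVec fun _ : Fin d => (0 : ℝ)) = 0 := by
    rw [DeltaXi_ofReal]; simp [DeltaXir, Sxir]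
  have hY : ∀ lam, Yc n lam (ofRealVec fun _ : Fin d => (0 : ℝ)) = 1 := by
    intro lam
    unfold Yc cfac
    rw [hΔ, zero_mul, add_zero, U_ofReal, Ur_zero_at_zero]
    simp [ofRealVec, uFactor]
  have hF : F66 n (ofRealVec fun _ : Fin d => (0 : ℝ)) = 1 := by
    rw [F66_ofReal, F66r_zero]; simp
  unfold W166
  rw [hF, div_one]
  exact Finset.prod_eq_one (fun lam _ => hY lam)

/-- `sinh t ≤ 2` for `t ≤ 1`. [folklore] -/
theorem sinh_le_two {t : ℝ} (ht1 : t ≤ 1) : Real.sinh t ≤ 2 := by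
  refine ((Real.sinh_le_sinh.mpr ht1).trans (Real.sinh_lt_cosh 1).le).trans ?_
  rw [Real.cosh_eq]
  have h1 : Real.exp 1 < 3 := lt_trans Real.exp_one_lt_d9 (by norm_num)
  have h2 : Real.exp (-1) ≤ 1 := Real.exp_le_one_iff.mpr (by norm_num)
  linarith

/-- **THE STRIP RATE OF THE (1.66) MULTIPLIER, interpolation family.**  For `n₂ = R·n₁` (`n₁, n₂ ≥ 1`), `μ ≠ ν`,
`0 < t ≤ 1` and every `p` in `Strip d (κ₁₆₆(d)·sinh t/2)`:
`‖W^{(n₂)}_{μν}(p) − W^{(n₁)}_{μν}(p)‖ ≤ (Crate(d)·n₁⁻²)^{(1−t)^d} · (2·MW(d))^{1−(1−t)^d}`.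
Inputs: the REAL rate `B5ActionRate166.w166_rate` (from the printed scalar layer, King's composition law), the strip
bound `B5Symbol166Strip.norm_W166_le`, the collar facts of §2 and the two-constants engine of §1.
[cite: Balaban1984PropagatorsI, (1.66) p.29 (formula location only)] [folklore] -/
theorem W166_strip_rate_family {n₁ n₂ R : ℕ} [NeZero n₁] [NeZero n₂] (h : n₂ = R * n₁) {μ ν : Fin d}
    (hμν : μ ≠ ν) {t : ℝ} (ht0 : 0 < t) (ht1 : t ≤ 1) :
    ∀ p ∈ Strip d (kappa166 d * Real.sinh t / 2),
      ‖W166 n₂ μ ν p - W166 n₁ μ ν p‖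
        ≤ (Crate d * ((n₁ : ℝ) ^ 2)⁻¹) ^ ((1 - t) ^ d) * (2 * MW d) ^ (1 - (1 - t) ^ d) := by
  subst h
  have hR : 1 ≤ R := by
    rcases Nat.eq_zero_or_pos R with h0 | h0
    · exfalso; apply NeZero.ne (R * n₁); rw [h0, zero_mul]
    · exact h0
  haveI : NeZero R := ⟨by omega⟩
  have hn₁ : 1 ≤ n₁ := Nat.one_le_iff_ne_zero.mpr (NeZero.ne n₁)
  have hn₂ : 1 ≤ R * n₁ := Nat.one_le_iff_ne_zero.mpr (NeZero.ne (R * n₁))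
  have hκ0 := (kappa166_pos d).le
  have hst : 0 ≤ Real.sinh t := Real.sinh_nonneg_iff.mpr ht0.le
  have hMW := (MW_pos d).le
  refine strip_interpolation (g := fun p => W166 (R * n₁) μ ν p - W166 n₁ μ ν p) (κ := kappa166 d)
    (κ' := kappa166 d * Real.sinh t / 2) (by positivity) ?_ ht0 ht1 (le_of_eq (by ring))
    (mul_nonneg (Crate_nonneg d) (by positivity)) (by positivity) ?_ ?_ ?_
  · have := sinh_le_two ht1
    nlinarith
  · intro i q hq
    obtain ⟨hd2, hb2⟩ := W166_collar (R * n₁) hκ0 le_rfl hq hμν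
    obtain ⟨hd1, hb1⟩ := W166_collar n₁ hκ0 le_rfl hq hμν
    exact ⟨hd2.sub hd1, (norm_sub_le _ _).trans (by linarith)⟩
  · intro i q hq him
    obtain ⟨hs', h2⟩ := W166_collar_real (R * n₁) hκ0 le_rfl hq him hμν
    obtain ⟨_, h1⟩ := W166_collar_real n₁ hκ0 le_rfl hq him hμν
    exact ⟨(zoneRep q i i).re, hs', by simp only [h1, h2]⟩
  · intro s hs
    show ‖W166 (R * n₁) μ ν (ofRealVec s) - W166 n₁ μ ν (ofRealVec s)‖ ≤ _
    by_cases h0 : ∃ ν₀, s ν₀ ≠ 0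
    · obtain ⟨ν₀, hν₀⟩ := h0
      rw [W166_ofReal (R * n₁) hn₂ hμν s hs ν₀ hν₀, W166_ofReal n₁ hn₁ hμν s hs ν₀ hν₀, ← Complex.ofReal_sub,
        Complex.norm_real, Real.norm_eq_abs, abs_sub_comm]
      exact w166_rate hn₁ hR μ ν s hs ν₀ hν₀
    · push Not at h0
      have hs0 : s = fun _ => (0 : ℝ) := funext h0
      rw [hs0, W166_origin, W166_origin, sub_self, norm_zero]
      exact mul_nonneg (Crate_nonneg d) (by positivity)

/-- the strip-rate constant `√(2·MW(d)·Crate(d))`. [folklore] -/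
def CWs (d : ℕ) : ℝ := Real.sqrt (2 * MW d * Crate d)

/-- `0 ≤ CWs d`. [folklore] -/
theorem CWs_nonneg (d : ℕ) : 0 ≤ CWs d := Real.sqrt_nonneg _

/-- **THE STRIP RATE OF THE (1.66) MULTIPLIER, exponent `γ = 1`.**  For `n₂ = R·n₁`, `μ ≠ ν` and every `p` in the
`k`-uniform strip `Strip d (κ₁₆₆(d)/(4d))`:  `‖W^{(n₂)}_{μν}(p) − W^{(n₁)}_{μν}(p)‖ ≤ CWs(d) · n₁⁻¹`
(the family at `t = 1/(2d)`, where `(1−t)^d ≥ 1/2` by Bernoulli).  With `n₁ = L^k` this is King's `O(L^{−γk})`,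
`γ = 1`. [cite: Balaban1984PropagatorsI, (1.66) p.29 (formula location only)] [folklore] -/
theorem W166_strip_rate {n₁ n₂ R : ℕ} [NeZero n₁] [NeZero n₂] (h : n₂ = R * n₁) {μ ν : Fin d}
    (hμν : μ ≠ ν) {p : Fin d → ℂ} (hp : p ∈ Strip d (kappa166 d / (4 * d))) :
    ‖W166 n₂ μ ν p - W166 n₁ μ ν p‖ ≤ CWs d * (n₁ : ℝ)⁻¹ := by
  have hd := two_le_of_ne hμν
  have hdr : (2 : ℝ) ≤ d := by exact_mod_cast hd
  have hκ := kappa166_pos d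
  have hn₁ : (1 : ℝ) ≤ n₁ := by exact_mod_cast Nat.one_le_iff_ne_zero.mpr (NeZero.ne n₁)
  set t : ℝ := 1 / (2 * d) with ht
  have ht0 : 0 < t := by positivity
  have ht1 : t ≤ 1 := by
    rw [ht, div_le_one (by positivity)]; linarith
  have hsinh : t ≤ Real.sinh t := Real.self_le_sinh_iff.mpr ht0.le
  have hp' : p ∈ Strip d (kappa166 d * Real.sinh t / 2) := by
    intro μ'
    refine ⟨(hp μ').1, (hp μ').2.trans ?_⟩
    calc kappa166 d / (4 * d) = kappa166 d * t / 2 := by rw [ht]; field_simp; ring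
      _ ≤ kappa166 d * Real.sinh t / 2 := by gcongr
  have key := W166_strip_rate_family h hμν ht0 ht1 p hp'
  set a : ℝ := (1 - t) ^ d with ha
  have ha_half : 1 / 2 ≤ a := by
    have hb := one_add_mul_le_pow (show (-2 : ℝ) ≤ -t by linarith) d
    have e : (d : ℝ) * (-t) = -1 / 2 := by rw [ht]; field_simp
    rw [e, ← sub_eq_add_neg] at hb
    rw [ha]; linarith
  have ha1 : a ≤ 1 := pow_le_one₀ (by linarith) (by linarith)
  set m : ℝ := Crate d * ((n₁ : ℝ) ^ 2)⁻¹ with hm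
  set M : ℝ := 2 * MW d with hM
  have hm0 : 0 ≤ m := mul_nonneg (Crate_nonneg d) (by positivity)
  have hM0 : 0 < M := by have := MW_pos d; positivity
  have hpS : p ∈ Strip d (kappa166 d) := by
    intro μ'
    refine ⟨(hp μ').1, (hp μ').2.trans (div_le_self hκ.le (by linarith))⟩
  have htriv : ‖W166 n₂ μ ν p - W166 n₁ μ ν p‖ ≤ M :=
    (norm_sub_le _ _).trans (by
      have h2 := norm_W166_le n₂ hκ.le le_rfl hpS μ ν
      have h1 := norm_W166_le n₁ hκ.le le_rfl hpS μ ν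
      rw [hM]; linarith)
  have htarget : CWs d * (n₁ : ℝ)⁻¹ = m ^ (1 / 2 : ℝ) * M ^ (1 / 2 : ℝ) := by
    unfold CWs
    rw [← Real.mul_rpow hm0 hM0.le, ← Real.sqrt_eq_rpow,
      show m * M = (2 * MW d * Crate d) * ((n₁ : ℝ)⁻¹) ^ 2 by rw [hm, hM]; ring,
      Real.sqrt_mul (by have := MW_pos d; have := Crate_nonneg d; positivity) (((n₁ : ℝ)⁻¹) ^ 2),
      Real.sqrt_sq (by positivity)]
  rw [htarget]
  by_cases hmM : m ≤ M
  · refine key.trans ?_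
    have h1 : m ^ a ≤ m ^ (1 / 2 : ℝ) * M ^ (a - 1 / 2) := by
      rw [show m ^ a = m ^ (1 / 2 : ℝ) * m ^ (a - 1 / 2) by
        rw [← Real.rpow_add_of_nonneg hm0 (by norm_num) (by linarith)]; congr 1; ring]
      gcongr
    calc m ^ a * M ^ (1 - a) ≤ m ^ (1 / 2 : ℝ) * M ^ (a - 1 / 2) * M ^ (1 - a) := by gcongr
      _ = m ^ (1 / 2 : ℝ) * M ^ (1 / 2 : ℝ) := by
          rw [mul_assoc, ← Real.rpow_add hM0]; norm_num
  · push Not at hmM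
    refine htriv.trans ?_
    calc M = M ^ (1 / 2 : ℝ) * M ^ (1 / 2 : ℝ) := by rw [← Real.rpow_add hM0]; norm_num
      _ ≤ m ^ (1 / 2 : ℝ) * M ^ (1 / 2 : ℝ) :=
          mul_le_mul_of_nonneg_right (Real.rpow_le_rpow hM0.le hmM.le (by norm_num)) (Real.rpow_nonneg hM0.le _)

/-- KING'S SHAPE: for `L ≥ 1`, all `k, m`, `μ ≠ ν`, on `Strip d (κ₁₆₆(d)/(4d))`:
`‖W^{(L^{k+m})}_{μν}(p) − W^{(L^k)}_{μν}(p)‖ ≤ CWs(d) · L^{−k}` — an η-rate with `η = L⁻¹`, exponent `γ = 1`, UNIFORM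
in `m` and in `p` on the strip. [cite: King1986, Props. 3.8/3.9 pp. 335–339 (exponent convention, location only)] [folklore] -/
theorem W166_strip_rate_king (L k m : ℕ) [NeZero L] {μ ν : Fin d} (hμν : μ ≠ ν) {p : Fin d → ℂ}
    (hp : p ∈ Strip d (kappa166 d / (4 * d))) :
    ‖W166 (L ^ (k + m)) μ ν p - W166 (L ^ k) μ ν p‖ ≤ CWs d * ((L : ℝ) ^ k)⁻¹ := by
  have h := W166_strip_rate (n₁ := L ^ k) (n₂ := L ^ (k + m)) (R := L ^ m) (by rw [pow_add, mul_comm]) hμν hp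
  simpa using h

/-- THE `θ^k` FORM of the consumer spec (S2) («`sup_strip |X̂_{k+1} − X̂_k| ≤ C′θ^k`», `θ = L⁻¹`): consecutive
scales, `‖W^{(L^{k+1})}_{μν}(p) − W^{(L^k)}_{μν}(p)‖ ≤ CWs(d) · (L⁻¹)^k` on `Strip d (κ₁₆₆(d)/(4d))`; the companion
uniform bound `‖W^{(n)}_{μν}(p)‖ ≤ MW(d)` is `B5Symbol166Strip.norm_W166_le`. [folklore] -/
theorem W166_strip_rate_theta (L k : ℕ) [NeZero L] {μ ν : Fin d} (hμν : μ ≠ ν) {p : Fin d → ℂ}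
    (hp : p ∈ Strip d (kappa166 d / (4 * d))) :
    ‖W166 (L ^ (k + 1)) μ ν p - W166 (L ^ k) μ ν p‖ ≤ CWs d * ((L : ℝ)⁻¹) ^ k := by
  rw [inv_pow]
  exact W166_strip_rate_king L k 1 hμν hp

/-- `e^κ + 1 ≤ 4` on the strips in use (`κ ≤ 1`). [folklore] -/
theorem exp_add_one_le_four {κ : ℝ} (hκ1 : κ ≤ 1) : Real.exp κ + 1 ≤ 4 := by
  have h1 : Real.exp κ ≤ Real.exp 1 := Real.exp_le_exp.mpr hκ1
  have h2 : Real.exp 1 < 3 := lt_trans Real.exp_one_lt_d9 (by norm_num)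
  linarith

/-- `κ₁₆₆(d)/(4d) ≤ κ₁₆₆(d)` and `≤ 1` (`d ≥ 1`). [folklore] -/
theorem kappa166_div_le (hd : 1 ≤ d) : kappa166 d / (4 * d) ≤ kappa166 d ∧ kappa166 d / (4 * d) ≤ 1 := by
  have hκ := kappa166_pos d
  have hdr : (1 : ℝ) ≤ d := by exact_mod_cast hd
  have h1 : kappa166 d / (4 * d) ≤ kappa166 d := div_le_self hκ.le (by linarith)
  exact ⟨h1, h1.trans (((kappa166_le_rOf d).trans (rOf_le d)).trans (by norm_num))⟩

/-- **THE STRIP RATE OF THE ENTRY SYMBOL** `Gsym = ½·W·(e^{−ip_a} − 1)(e^{ip_b} − 1)`: on `Strip d (κ₁₆₆(d)/(4d))`,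
`‖Gsym^{(n₂)} − Gsym^{(n₁)}‖ ≤ 8·CWs(d)·n₁⁻¹` (`n₂ = R·n₁`, `μ ≠ ν`). [folklore] -/
theorem Gsym_strip_rate {n₁ n₂ R : ℕ} [NeZero n₁] [NeZero n₂] (h : n₂ = R * n₁) {μ ν : Fin d} (hμν : μ ≠ ν)
    (a b : Fin d) {p : Fin d → ℂ} (hp : p ∈ Strip d (kappa166 d / (4 * d))) :
    ‖Gsym n₂ μ ν a b p - Gsym n₁ μ ν a b p‖ ≤ 8 * CWs d * (n₁ : ℝ)⁻¹ := by
  have hd := two_le_of_ne hμν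
  have hW := W166_strip_rate h hμν hp
  have hκ1 := (kappa166_div_le (d := d) (by omega)).2
  have he := exp_add_one_le_four hκ1
  have hN := ((norm_expFac_le hp a).1).trans he
  have hP := ((norm_expFac_le hp b).2).trans he
  have hC := CWs_nonneg d
  unfold Gsym
  rw [show 1 / 2 * W166 n₂ μ ν p * (expFacNeg a p * expFacPos b p)
      - 1 / 2 * W166 n₁ μ ν p * (expFacNeg a p * expFacPos b p)
      = 1 / 2 * ((W166 n₂ μ ν p - W166 n₁ μ ν p) * (expFacNeg a p * expFacPos b p)) by ring,
    norm_mul, norm_mul, norm_mul]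
  have h12 : ‖(1 / 2 : ℂ)‖ = 1 / 2 := by norm_num
  rw [h12]
  calc 1 / 2 * (‖W166 n₂ μ ν p - W166 n₁ μ ν p‖ * (‖expFacNeg a p‖ * ‖expFacPos b p‖))
      ≤ 1 / 2 * (CWs d * (n₁ : ℝ)⁻¹ * (4 * 4)) := by gcongr
    _ = 8 * CWs d * (n₁ : ℝ)⁻¹ := by ring

/-! ## §4  `StripRegular` packages of the differences (dimension `d + 1`) -/

/-- the DIFFERENCE `W^{(n₂)} − W^{(n₁)}` is strip regular on `Strip (d+1) κ`, `0 ≤ κ ≤ κ₁₆₆(d+1)/(4(d+1))`, with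
bound THE RATE `CWs(d+1)·n₁⁻¹`. [folklore] -/
theorem stripRegular_W166_sub {n₁ n₂ R : ℕ} [NeZero n₁] [NeZero n₂] (h : n₂ = R * n₁) {κ : ℝ} (hκ0 : 0 ≤ κ)
    (hκ : κ ≤ kappa166 (d + 1) / (4 * ((d : ℝ) + 1))) {μ ν : Fin (d + 1)} (hμν : μ ≠ ν) :
    StripRegular (d := d) (fun p => W166 n₂ μ ν p - W166 n₁ μ ν p) κ (CWs (d + 1) * (n₁ : ℝ)⁻¹) := by
  have hdiv := kappa166_div_le (d := d + 1) (by omega)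
  push_cast at hdiv
  have hκ' : κ ≤ kappa166 (d + 1) := hκ.trans hdiv.1
  have h₂ := stripRegular_W166 (d := d) n₂ hκ0 hκ' hμν
  have h₁ := stripRegular_W166 (d := d) n₁ hκ0 hκ' hμν
  refine ⟨h₂.cont.sub h₁.cont, fun i q hq => (h₂.diff i q hq).sub (h₁.diff i q hq), ?_, ?_⟩
  · intro i q hq y hy
    show W166 n₂ μ ν _ - W166 n₁ μ ν _ = W166 n₂ μ ν _ - W166 n₁ μ ν _
    rw [h₂.sides i q hq y hy, h₁.sides i q hq y hy]
  · intro p hp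
    have hp' : p ∈ Strip (d + 1) (kappa166 (d + 1) / (4 * ((d + 1 : ℕ) : ℝ))) := fun μ' =>
      ⟨(hp μ').1, (hp μ').2.trans (by push_cast; exact hκ)⟩
    exact W166_strip_rate h hμν hp'

/-- the DIFFERENCE `Gsym^{(n₂)} − Gsym^{(n₁)}` is strip regular with bound `8·CWs(d+1)·n₁⁻¹`. [folklore] -/
theorem stripRegular_Gsym_sub {n₁ n₂ R : ℕ} [NeZero n₁] [NeZero n₂] (h : n₂ = R * n₁) {κ : ℝ} (hκ0 : 0 ≤ κ)
    (hκ : κ ≤ kappa166 (d + 1) / (4 * ((d : ℝ) + 1))) {μ ν : Fin (d + 1)} (hμν : μ ≠ ν)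
    (a b : Fin (d + 1)) :
    StripRegular (d := d) (fun p => Gsym n₂ μ ν a b p - Gsym n₁ μ ν a b p) κ
      (8 * CWs (d + 1) * (n₁ : ℝ)⁻¹) := by
  have hdiv := kappa166_div_le (d := d + 1) (by omega)
  push_cast at hdiv
  have hκ' : κ ≤ kappa166 (d + 1) := hκ.trans hdiv.1
  have h₂ := stripRegular_Gsym (d := d) n₂ hκ0 hκ' hμν a b
  have h₁ := stripRegular_Gsym (d := d) n₁ hκ0 hκ' hμν a b
  refine ⟨h₂.cont.sub h₁.cont, fun i q hq => (h₂.diff i q hq).sub (h₁.diff i q hq), ?_, ?_⟩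
  · intro i q hq y hy
    show Gsym n₂ μ ν a b _ - Gsym n₁ μ ν a b _ = Gsym n₂ μ ν a b _ - Gsym n₁ μ ν a b _
    rw [h₂.sides i q hq y hy, h₁.sides i q hq y hy]
  · intro p hp
    have hp' : p ∈ Strip (d + 1) (kappa166 (d + 1) / (4 * ((d + 1 : ℕ) : ℝ))) := fun μ' =>
      ⟨(hp μ').1, (hp μ').2.trans (by push_cast; exact hκ)⟩
    exact Gsym_strip_rate h hμν a b hp'

/-- POSITION SPACE ON `ℤ^{d+1}`: the lattice kernel of the difference of the multipliers decays exponentially with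
amplitude THE RATE: `‖K^{(n₂)}(x) − K^{(n₁)}(x)‖ ≤ 8·CWs(d+1)·n₁⁻¹ · e^{−κ′|x|_∞}`, `κ′ = κ₁₆₆(d+1)/(4(d+1))`
(`B4ContourShift.latticeKernel_decay`). [cite: Balaban1984PropagatorsI, p.38 before (1.126) (method location only)]
[folklore] -/
theorem latticeKernel_Gsym_rate {n₁ n₂ R : ℕ} [NeZero n₁] [NeZero n₂] (h : n₂ = R * n₁)
    {μ ν : Fin (d + 1)} (hμν : μ ≠ ν) (a b : Fin (d + 1)) (x : Fin (d + 1) → ℤ) :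
    ‖latticeKernel (fun p => Gsym n₂ μ ν a b p - Gsym n₁ μ ν a b p) x‖
      ≤ 8 * CWs (d + 1) * (n₁ : ℝ)⁻¹
          * Real.exp (-(kappa166 (d + 1) / (4 * ((d : ℝ) + 1)) * supNorm x)) := by
  have hκ0 : 0 ≤ kappa166 (d + 1) / (4 * ((d : ℝ) + 1)) := by
    have := kappa166_pos (d + 1); positivity
  exact latticeKernel_decay (stripRegular_Gsym_sub h hκ0 le_rfl hμν a b) hκ0 x

/-! ## §5  Position space on the torus: the rate WITH exponential decay, uniformly in the volume -/

section Torus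

open Literature.MathematicalPhysics.QuantumFieldTheory.Balaban1983to89.B4TorusKernel
  (descend descendC descendC_apply periodConst)
open Literature.MathematicalPhysics.QuantumFieldTheory.Balaban1983to89.B4TorusKernel.MultiPeriod
  (torusSum torusKernel torusSupNorm torusKernel_descend_decay_torusMetric)
open Literature.MathematicalPhysics.QuantumFieldTheory.Balaban1983to89.B5Prop11Plancherel (Tor)
open Literature.MathematicalPhysics.QuantumFieldTheory.Balaban1983to89.B6LowerBound2153Torus (toT)
open Literature.MathematicalPhysics.QuantumFieldTheory.Balaban1983to89.B6Cov2156Torus (one_le_M)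
open Literature.MathematicalPhysics.QuantumFieldTheory.Balaban1983to89.B5Kernel166Decay
  (ksum ksum_toT_eq_torusKernel)

/-- LINEARITY of the torus kernel of a descended multiplier: the difference of the torus kernels of two strip-regular
multipliers is the torus kernel of their difference. [folklore] -/
theorem torusKernel_descendC_sub {G₁ G₂ : (Fin (d + 1) → ℂ) → ℂ} {κ M₁ M₂ M₃ : ℝ}
    (h₁ : StripRegular G₁ κ M₁) (h₂ : StripRegular G₂ κ M₂)
    (h₁₂ : StripRegular (fun p => G₂ p - G₁ p) κ M₃) (hκ : 0 ≤ κ) (N : Fin (d + 1) → ℕ)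
    (x : Fin (d + 1) → ℤ) :
    torusKernel (descendC G₂ h₂ hκ) N x - torusKernel (descendC G₁ h₁ hκ) N x
      = torusKernel (descendC (fun p => G₂ p - G₁ p) h₁₂ hκ) N x := by
  unfold torusKernel torusSum
  rw [← mul_sub, ← Finset.sum_sub_distrib]
  congr 1
  refine Finset.sum_congr rfl fun k _ => ?_
  rw [descendC_apply, descendC_apply, descendC_apply]
  unfold descend
  ring

variable (M : Fin (d + 1) → ℕ) [hM : ∀ μ, NeZero (M μ)]

/-- **THE η-RATE OF THE KERNELS OF BAŁABAN'S `Δ_k` (U = 1) IN POSITION SPACE, WITH EXPONENTIAL DECAY, UNIFORMLY IN THE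
VOLUME.**  On every torus `Π_μ ℤ/M_μ` (`M_μ ≥ 1`), for `n₂ = R·n₁`, `μ ≠ ν`, all `a, b` and every lattice vector `x`:
`‖ksum_M^{(n₂)}(x̄) − ksum_M^{(n₁)}(x̄)‖ ≤ 8·CWs(d+1)·n₁⁻¹ · periodConst(κ′) · e^{−(κ′/(d+1))·|x|_{T,∞}}`,
`κ′ = κ₁₆₆(d+1)/(4(d+1))` — the entries `½ Σ_t χ_t(z̄) w^{(n)}_{μν}(s(t)) conj φ_t(e_a) φ_t(e_b) / |T|` of the kernel of
the (1.66) form (`B5Kernel166Decay.ksum`) converge at King's rate `γ = 1` in the STRONGEST (exponentially weighted)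
norm.  With `n₁ = L^k`: `O(L^{−k})` uniformly in `n₂ = L^{k+m}`, in `x` and in the period vector `M`.
[cite: Balaban1984PropagatorsI, (1.66) p.29, p.38 before (1.126) (locations only)] [folklore] -/
theorem ksum_rate {n₁ n₂ R : ℕ} [NeZero n₁] [NeZero n₂] (h : n₂ = R * n₁) {μ ν : Fin (d + 1)} (hμν : μ ≠ ν)
    (a b : Fin (d + 1)) (x : Fin (d + 1) → ℤ) :
    ‖ksum M n₂ μ ν a b (toT M x) - ksum M n₁ μ ν a b (toT M x)‖
      ≤ 8 * CWs (d + 1) * (n₁ : ℝ)⁻¹ * periodConst (kappa166 (d + 1) / (4 * ((d : ℝ) + 1))) d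
          * Real.exp (-(kappa166 (d + 1) / (4 * ((d : ℝ) + 1)) / (d + 1) * torusSupNorm M x)) := by
  have hdiv := kappa166_div_le (d := d + 1) (by omega)
  push_cast at hdiv
  have hκ'0 : 0 < kappa166 (d + 1) / (4 * ((d : ℝ) + 1)) := by
    have := kappa166_pos (d + 1); positivity
  rw [ksum_toT_eq_torusKernel M n₂ hκ'0 hdiv.1 hμν a b x, ksum_toT_eq_torusKernel M n₁ hκ'0 hdiv.1 hμν a b x,
    torusKernel_descendC_sub (stripRegular_Gsym n₁ hκ'0.le hdiv.1 hμν a b)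
      (stripRegular_Gsym n₂ hκ'0.le hdiv.1 hμν a b) (stripRegular_Gsym_sub h hκ'0.le le_rfl hμν a b) hκ'0.le M x]
  exact torusKernel_descend_decay_torusMetric _ hκ'0 (one_le_M M) x

/-- KING'S SHAPE of the position-space rate: `n₁ = L^k`, `n₂ = L^{k+m}`, amplitude `8·CWs(d+1)·L^{−k}`. [folklore] -/
theorem ksum_rate_king (L k m : ℕ) [NeZero L] {μ ν : Fin (d + 1)} (hμν : μ ≠ ν) (a b : Fin (d + 1))
    (x : Fin (d + 1) → ℤ) :
    ‖ksum M (L ^ (k + m)) μ ν a b (toT M x) - ksum M (L ^ k) μ ν a b (toT M x)‖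
      ≤ 8 * CWs (d + 1) * ((L : ℝ) ^ k)⁻¹ * periodConst (kappa166 (d + 1) / (4 * ((d : ℝ) + 1))) d
          * Real.exp (-(kappa166 (d + 1) / (4 * ((d : ℝ) + 1)) / (d + 1) * torusSupNorm M x)) := by
  have h := ksum_rate M (n₁ := L ^ k) (n₂ := L ^ (k + m)) (R := L ^ m) (by rw [pow_add, mul_comm]) hμν a b x
  simpa using h

end Torus

end Literature.MathematicalPhysics.QuantumFieldTheory.Balaban1983to89.T4GaugeActionRateStrip
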